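import Summits.QuantumFields.YangMills.Theorems.FluctuationComparisonRegPrIntLOrganTangentAPackageFromHeight
import Summits.QuantumFields.YangMills.Theorems.FluctuationComparisonRegPrIntLOrganTangentWindowAbsCont
import Summits.QuantumFields.YangMills.Theorems.FluctuationComparisonRegPrIntLOrganTangentDescendSection
import Summits.QuantumFields.YangMills.Theorems.FluctuationComparisonRegPrIntLSpreadLiftAllL
import Literature.MathematicalPhysics.QuantumFieldTheory.Balaban1983to89.B12ContinuousTransportInvariance
import Summits.QuantumFields.YangMills.Theorems.BalabanUVNodesN07DirectMethod
import HarnessLib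

/-!
# `FluctuationComparisonRegPrIntLOrganTangentWindowAbsContFromHeight` — (L11) COAREA∘ SUPPORT (t′): the chart letters from a height, PACKAGED, and
# `dU_j⌊{PlaqSmall θ_j} ≪ (descend F ℰp j)_* dU_{j+1}` FROM A HEIGHT, for every family

Cell `ym3-torus` (rung R3 = continuum `SU(2)` Yang–Mills on T³ — NOT d = 4, NOT infinite volume, NOT a mass gap, NOT Clay), width seat `ym-ust-20520-w5` (gen 21), pen (L11)
(LEAD w3 g23 21:16:58Z: «(t′) instantiate from a height … is the piece I leave to your line»).  `--kind proof --supports stmt-QuantumFields-20520 --as helper`,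
count-neutral, definition-free, default heartbeats; THEOREMS ONLY; nothing printed is asserted.

§1 ★★ `exists_height_oneBondLaw` — ✓(L7) `oneBondLaw`'s nineteen chart-side clauses AT THE CONSTANTS OF ✓(L8) and the window `a := 24∕25·θ_{j+1}`, FROM A HEIGHT, packaged once
(the block (L8) runs inline).  §2 ★★★ `exists_height_window_absCont` — for every `F`, `0 < γ ≤ 1`, `0 < b₀`, `0 < p₀`: `∃ jA, ∀ j ≥ jA,
(fieldMeasure (F.P j)).restrict {PlaqSmall θ_j} ≪ (fieldMeasure (F.P (j+1))).map (descend F ℰp j)` — LEAD w3 g23's generic ✓`…OrganTangentWindowAbsCont.restrict_absolutelyContinuous_map_of_fibredChart`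
at the SPLICED triangular chart of the T⁴ engine (lit ✓`T4TriangularFibredChart.pi_restrict_preimage_inter_eq_map_prod_withDensity_splice` ∕ `apply_triChartSplice_eq`, section from
✓`…OrganTangentDescendSection`), whose FULL chart mass over a window datum `V` is positive because the good set `{U | ∀ c, V c ∈ T c U}` is OPEN (joint `hTo`), contains the
`24∕25·θ_{j+1}`-small lift of `V` (✓`SpreadLiftAllL.spreadLift_height_all` + `hsol`), product Haar charges open sets (✓`B12ContinuousTransportInvariance.isOpenPosMeasure_fieldMeasure_SU`),
and the Jacobian is positive there (`hjpos`).  NOT HERE: (u) `σ = σ₀`, (s) the separability swap, COAREA∘ itself; nothing of Bałaban's estimates.  No `def`, `instance`, `sorry`.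
-/

set_option autoImplicit false

noncomputable section

namespace Summit.QuantumFields.YangMills.Theorems.FluctuationComparisonRegPrIntLOrganTangentWindowAbsContFromHeight

open Set Function Filter Topology MeasureTheory
open scoped ENNReal NNReal
open Literature.MathematicalPhysics.QuantumFieldTheory.Balaban1983to89
open Literature.MathematicalPhysics.QuantumFieldTheory.Balaban1983to89.T3OrbitAverage
open T3ContinuumYM3Torus T3NestedUnitLaws T3UnitLawDensityEML T3UnitScaleTilt T3LevelShift T4Continuum AveragingRT BlockAveraging
open Literature.MathematicalPhysics.QuantumFieldTheory.Balaban1983to89.BlockAveragingHaarAC (centralBond IsCentral)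
open Literature.MathematicalPhysics.QuantumFieldTheory.Balaban1983to89.BlockAveragingEMLHaarAC (offCard)
open Literature.MathematicalPhysics.QuantumFieldTheory.Balaban1983to89.T4TriangularPushforward (IsLocal)
open ExpMeanLog (deltaSU deltaSU_pos)
open Summit.QuantumFields.YangMills.Theorems.OrganTangentTriangularChart (isLocal_descend injective_private)
open Summit.QuantumFields.YangMills.Theorems.FluctuationComparisonRegPrIntLOrganTangentOneBondLaw (oneBondLaw)
open Summit.QuantumFields.YangMills.Theorems.FluctuationComparisonRegPrIntLOrganTangentAPackageFromHeight
  (torus_d_L not_isCentral_corner offCard_div_card_le filterCard_eq_offCard)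
open Summit.QuantumFields.YangMills.Theorems.OrganTangentWindowAbsCont (restrict_absolutelyContinuous_map_of_fibredChart)
open Summit.QuantumFields.YangMills.Theorems.OrganTangentDescendSection (exists_continuous_section_descend)
open Summit.QuantumFields.YangMills.Theorems.SpreadLiftAllL (spreadLift_height_all)
open Summit.QuantumFields.YangMills.Theorems.OrganTangentAPackageAtDescend (liftFloor_lt_twentyFour_div_twentyFive)

/-! ## §1 The chart letters from a height, packaged -/

/-- ★★ **THE CHART LETTERS FROM A HEIGHT** — ✓(L7) `oneBondLaw`'s conclusion at `a := 24∕25·θ_{j+1}` and the explicit constants of ✓(L8), for all `j` from a height.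
[cite: Balaban1987RG1, (0.4) p.253, (2.4) p.266 and (2.10) p.267; Helgason2000, Ch. I §1 Thm. 1.14 (13) p.96] -/
theorem exists_height_oneBondLaw
    (F : T3Family) (γ b₀ p₀ : ℝ) (hγ : 0 < γ) (hγ1 : γ ≤ 1) (hb₀ : 0 < b₀) :
    ∃ jA : ℕ, ∀ (j : ℕ), jA ≤ j →
      ∃ (Ω T T' : PBond (F.P j) 0 → GaugeField (F.P (j + 1)) 0 ↥(Matrix.specialUnitaryGroup (Fin 2) ℂ) → Set ↥(Matrix.specialUnitaryGroup (Fin 2) ℂ))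
        (θ : PBond (F.P j) 0 → GaugeField (F.P (j + 1)) 0 ↥(Matrix.specialUnitaryGroup (Fin 2) ℂ) →
          ↥(Matrix.specialUnitaryGroup (Fin 2) ℂ) → ↥(Matrix.specialUnitaryGroup (Fin 2) ℂ))
        (jac : PBond (F.P j) 0 → GaugeField (F.P (j + 1)) 0 ↥(Matrix.specialUnitaryGroup (Fin 2) ℂ) → ↥(Matrix.specialUnitaryGroup (Fin 2) ℂ) → ℝ≥0) (M : ℝ≥0),
        -- measurability (hΩm hTm hθm hjm)
        (∀ c, MeasurableSet {p : GaugeField (F.P (j + 1)) 0 ↥(Matrix.specialUnitaryGroup (Fin 2) ℂ) × ↥(Matrix.specialUnitaryGroup (Fin 2) ℂ) | p.2 ∈ Ω c p.1}) ∧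
        (∀ c, MeasurableSet {p : GaugeField (F.P (j + 1)) 0 ↥(Matrix.specialUnitaryGroup (Fin 2) ℂ) × ↥(Matrix.specialUnitaryGroup (Fin 2) ℂ) | p.2 ∈ T c p.1}) ∧
        (∀ c, Measurable fun p : GaugeField (F.P (j + 1)) 0 ↥(Matrix.specialUnitaryGroup (Fin 2) ℂ) × ↥(Matrix.specialUnitaryGroup (Fin 2) ℂ) => θ c p.1 p.2) ∧
        (∀ c, Measurable fun p : GaugeField (F.P (j + 1)) 0 ↥(Matrix.specialUnitaryGroup (Fin 2) ℂ) × ↥(Matrix.specialUnitaryGroup (Fin 2) ℂ) => jac c p.1 p.2) ∧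
        -- blindness of the fine domain (hΩbl)
        (∀ c (U : GaugeField (F.P (j + 1)) 0 ↥(Matrix.specialUnitaryGroup (Fin 2) ℂ)) (g : PBond (F.P j) 0 → ↥(Matrix.specialUnitaryGroup (Fin 2) ℂ)),
          Ω c (extend (fun c : PBond (F.P j) 0 => centralBond (bondShift (sitesPerDir_descend F j 0) c)) g U) = Ω c U) ∧
        -- right inverse (hright) and THE LAW (hlaw)
        (∀ c U, ∀ v ∈ T c U, descend F ℰp j (update U (centralBond (bondShift (sitesPerDir_descend F j 0) c)) (θ c U v)) c = v) ∧
        (∀ c U, (HaarData.haar : Measure ↥(Matrix.specialUnitaryGroup (Fin 2) ℂ)).restrict (Ω c U) =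
          (((HaarData.haar : Measure ↥(Matrix.specialUnitaryGroup (Fin 2) ℂ)).restrict (T c U)).withDensity fun v => (jac c U v : ℝ≥0∞)).map (θ c U)) ∧
        -- topology (hTo hT′T) and the margin
        (∀ c U, IsOpen (T c U)) ∧ (∀ c U, closure (T' c U) ⊆ T c U) ∧
        (∀ (U : GaugeField (F.P (j + 1)) 0 ↥(Matrix.specialUnitaryGroup (Fin 2) ℂ)) (V : GaugeField (F.P j) 0 ↥(Matrix.specialUnitaryGroup (Fin 2) ℂ)),
          (∀ c, V c ∈ T c U) → PlaqSmall (24 / 25 * θBal F.L γ b₀ p₀ (j + 1)) (extend (fun c : PBond (F.P j) 0 => centralBond (bondShift (sitesPerDir_descend F j 0) c)) (fun c => θ c U (V c)) U) → ∀ c, V c ∈ T' c U) ∧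
        -- small fields (hΩS), continuity (hθc hjc), the uniform bound (hjM)
        (∀ U : GaugeField (F.P (j + 1)) 0 ↥(Matrix.specialUnitaryGroup (Fin 2) ℂ), PlaqSmall (24 / 25 * θBal F.L γ b₀ p₀ (j + 1)) U → ∀ c, U (centralBond (bondShift (sitesPerDir_descend F j 0) c)) ∈ Ω c U) ∧
        (∀ c U, ContinuousOn (θ c U) (T c U)) ∧
        (∀ c U, ContinuousOn (fun v => (jac c U v : ℝ)) (T c U)) ∧
        (∀ c U v, jac c U v ≤ M) ∧
        -- the `mass_of_smallLift` letters (hTo, hθc joint; hsol) and positivity of the Jacobian on `T`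
        (∀ c, IsOpen {p : GaugeField (F.P (j + 1)) 0 ↥(Matrix.specialUnitaryGroup (Fin 2) ℂ) × ↥(Matrix.specialUnitaryGroup (Fin 2) ℂ) | p.2 ∈ T c p.1}) ∧
        (∀ c, ContinuousOn (fun p : GaugeField (F.P (j + 1)) 0 ↥(Matrix.specialUnitaryGroup (Fin 2) ℂ) × ↥(Matrix.specialUnitaryGroup (Fin 2) ℂ) =>
          θ c p.1 p.2) {p | p.2 ∈ T c p.1}) ∧
        (∀ U : GaugeField (F.P (j + 1)) 0 ↥(Matrix.specialUnitaryGroup (Fin 2) ℂ), PlaqSmall (24 / 25 * θBal F.L γ b₀ p₀ (j + 1)) U →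
          ∀ c, descend F ℰp j U c ∈ T' c U ∧ θ c U (descend F ℰp j U c) = U (centralBond (bondShift (sitesPerDir_descend F j 0) c))) ∧
        (∀ c U, ∀ v ∈ T c U, jac c U v ≠ 0) := by
  classical
  have hL3 : (3 : ℝ) ≤ F.L := by exact_mod_cast (torus_d_L F 0).2.2
  have hL0 : (0 : ℝ) < F.L := by linarith
  set δ : ℝ := deltaSU (Fin 2) with hδ
  have hδ0 : 0 < δ := deltaSU_pos
  -- `|Idx|` does not depend on the height (the torus parameters `d = 3`, `L = F.L` are the same at every height)
  have hcard : ∀ j : ℕ, (Fintype.card (Idx (F.P (j + 1))) : ℝ) = (Fintype.card (Idx (F.P 1)) : ℝ) := fun j => rfl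
  set ε : ℝ := ((Fintype.card (Idx (F.P 1)) : ℝ))⁻¹ with hε
  have hN0 : (0 : ℝ) < Fintype.card (Idx (F.P 1)) := by exact_mod_cast Fintype.card_pos
  have hε0 : 0 < ε := inv_pos.2 hN0
  have hε1 : ε ≤ 1 := inv_le_one_of_one_le₀ (by exact_mod_cast Fintype.card_pos)
  -- the radii
  set α₀ : ℝ := min (min (1 / 48) (δ / 64)) (min (1 / (314 * (F.L : ℝ) ^ 2)) (ε / 300)) with hα₀
  have hα₀pos : 0 < α₀ := by
    simp only [hα₀, lt_min_iff]; refine ⟨⟨by norm_num, by positivity⟩, by positivity, by positivity⟩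
  have hα₁ : α₀ ≤ 1 / 48 := (min_le_left _ _).trans (min_le_left _ _)
  have hα₂ : α₀ ≤ δ / 64 := (min_le_left _ _).trans (min_le_right _ _)
  have hα₃ : α₀ ≤ 1 / (314 * (F.L : ℝ) ^ 2) := (min_le_right _ _).trans (min_le_left _ _)
  have hα₄ : α₀ ≤ ε / 300 := (min_le_right _ _).trans (min_le_right _ _)
  set ρ : ℝ := α₀ * ε / 4 with hρ
  set s : ℝ := ε * ρ / 8 with hs
  set d₀ : ℝ := α₀ - ρ - s with hd₀
  set ρ'' : ℝ := ε * ρ / 4 with hρ''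
  have hρpos : 0 < ρ := by positivity
  have hspos : 0 < s := by positivity
  have hρα : ρ ≤ α₀ / 4 := by
    have h := mul_le_mul_of_nonneg_left hε1 hα₀pos.le; rw [hρ]; linarith
  have hsρ : s ≤ ρ / 8 := by
    have h := mul_le_mul_of_nonneg_right hε1 hρpos.le; rw [hs]; linarith
  have hd₀pos : 0 < d₀ := by rw [hd₀]; linarith
  have hsum : s + ρ + d₀ = α₀ := by rw [hd₀]; ring
  have hρ''pos : 0 < ρ'' := by positivity
  -- the threshold for `θ_{j+1}` and the height
  set τ : ℝ := min (min δ (s / 2)) (min (ρ'' / 14) ρ) / (6 * (F.L : ℝ) ^ 2 + 1) with hτ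
  have hτpos : 0 < τ := by positivity
  have hθ := (T3ThresholdSmallness.tendsto_θBal_atTop F.hL.2 hγ b₀ p₀).eventually (gt_mem_nhds hτpos)
  obtain ⟨j₁, hj₁⟩ := eventually_atTop.1 hθ
  refine ⟨j₁, fun j hj => ?_⟩
  have hθj : θBal F.L γ b₀ p₀ (j + 1) < τ := hj₁ (j + 1) (by omega)
  have hθpos : 0 < θBal F.L γ b₀ p₀ (j + 1) := T3MinimiserStabilityReduction.θBal_pos (by have := F.hL.2; omega) hγ hγ1 hb₀ p₀ (j + 1)
  -- the smallness `t = 6L²·(24∕25)·θ_{j+1}`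
  have ht_eq : (((((F.P (j + 1)).d + 2) * (F.P (j + 1)).L : ℕ) : ℝ) ^ 2 / 4) * (24 / 25 * θBal F.L γ b₀ p₀ (j + 1)) =
      6 * (F.L : ℝ) ^ 2 * θBal F.L γ b₀ p₀ (j + 1) := by
    have : ((F.P (j + 1)).d + 2) * (F.P (j + 1)).L = 5 * F.L := rfl
    rw [this]; push_cast; ring
  have htlt : 6 * (F.L : ℝ) ^ 2 * θBal F.L γ b₀ p₀ (j + 1) < min (min δ (s / 2)) (min (ρ'' / 14) ρ) := by
    have h1 : 6 * (F.L : ℝ) ^ 2 * θBal F.L γ b₀ p₀ (j + 1) < (6 * (F.L : ℝ) ^ 2 + 1) * τ := by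
      have h := mul_lt_mul_of_pos_left hθj (show (0 : ℝ) < 6 * (F.L : ℝ) ^ 2 by positivity)
      have h' : (6 * (F.L : ℝ) ^ 2 + 1) * τ = 6 * (F.L : ℝ) ^ 2 * τ + τ := by ring
      rw [h']; linarith
    have h2 : (6 * (F.L : ℝ) ^ 2 + 1) * τ = min (min δ (s / 2)) (min (ρ'' / 14) ρ) := by
      rw [hτ, mul_div_cancel₀ _ (by positivity)]
    linarith
  have htδ : 6 * (F.L : ℝ) ^ 2 * θBal F.L γ b₀ p₀ (j + 1) < δ := htlt.trans_le ((min_le_left _ _).trans (min_le_left _ _))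
  have hts : 6 * (F.L : ℝ) ^ 2 * θBal F.L γ b₀ p₀ (j + 1) < s / 2 := htlt.trans_le ((min_le_left _ _).trans (min_le_right _ _))
  have htρ'' : 6 * (F.L : ℝ) ^ 2 * θBal F.L γ b₀ p₀ (j + 1) < ρ'' / 14 := htlt.trans_le ((min_le_right _ _).trans (min_le_left _ _))
  have htρ : 6 * (F.L : ℝ) ^ 2 * θBal F.L γ b₀ p₀ (j + 1) < ρ := htlt.trans_le ((min_le_right _ _).trans (min_le_right _ _))
  -- the off-central fractions
  have hμ : ∀ c : PBond (F.P j) 0, (offCard (bondShift (sitesPerDir_descend F j 0) c) : ℝ) / (Fintype.card (Idx (F.P (j + 1))) : ℝ) ≤ 1 - ε :=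
    fun c => by rw [hε, ← hcard j]; exact offCard_div_card_le F (j + 1) 0 _
  -- Stage 2 at these constants
  exact oneBondLaw F j _ (fun c => not_isCentral_corner F (j + 1) 0 (bondShift (sitesPerDir_descend F j 0) c))
      (s := s) (ρ := ρ) (d₀ := d₀) (ρ'' := ρ'') (a := 24 / 25 * θBal F.L γ b₀ p₀ (j + 1))
      hspos hρpos.le hd₀pos (by rw [hsum]; linarith) (by rw [hsum]; linarith)
      (fun c => by rw [filterCard_eq_offCard, hsum]; linarith [hμ c])
      hρ''pos
      (fun c => by
        rw [filterCard_eq_offCard]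
        have hμc := hμ c
        have hsr0 : 0 ≤ s + ρ := by positivity
        -- μ(s+ρ) ≤ (s+ρ) − ερ
        have h1 : (offCard (bondShift (sitesPerDir_descend F j 0) c) : ℝ) / (Fintype.card (Idx (F.P (j + 1))) : ℝ) * (s + ρ) ≤ s + ρ - ε * ρ := by
          have h := mul_le_mul_of_nonneg_right hμc hsr0
          have h' : (1 - ε) * (s + ρ) = s + ρ - ε * s - ε * ρ := by ring
          rw [h'] at h; linarith [mul_nonneg hε0.le hspos.le]
        -- (s+ρ)² ≤ (81/64) ρ²
        have h2 : (s + ρ) ^ 2 ≤ 81 / 64 * ρ ^ 2 := by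
          have hle : s + ρ ≤ 9 / 8 * ρ := by linarith
          have h := mul_le_mul hle hle hsr0 (by positivity)
          have h' : 9 / 8 * ρ * (9 / 8 * ρ) = 81 / 64 * ρ ^ 2 := by ring
          rw [← pow_two, h'] at h; exact h
        -- ρ² ≤ ερ/192
        have hρε : ρ ≤ ε / 192 := by
          have h := mul_le_mul_of_nonneg_right hα₁ hε0.le; rw [hρ]; linarith
        have h3 : ρ ^ 2 ≤ ε * ρ / 192 := by
          have h := mul_le_mul_of_nonneg_left hρε hρpos.le
          have h' : ρ * (ε / 192) = ε * ρ / 192 := by ring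
          rw [pow_two, ← h']; exact h
        have h4 : 0 < ε * ρ := mul_pos hε0 hρpos
        rw [hρ'']; rw [hs] at h1 h2 ⊢; linarith)
      (mul_pos (by norm_num) hθpos).le (by rw [ht_eq]; exact htδ) (by rw [ht_eq]; linarith) (by rw [ht_eq]; exact htρ.le) (by rw [ht_eq]; linarith)
      (by rw [hsum]; linarith)
      (by
        rw [hsum, (torus_d_L F (j + 1)).1]
        show 157 * α₀ < ((F.L : ℝ) ^ (3 - 1))⁻¹
        have hL2 : (0 : ℝ) < (F.L : ℝ) ^ 2 := by positivity
        have key : α₀ * (314 * (F.L : ℝ) ^ 2) ≤ 1 := (le_div_iff₀ (by positivity)).1 hα₃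
        have h1 : 157 * α₀ * (F.L : ℝ) ^ 2 < 1 := by
          have h' : 157 * α₀ * (F.L : ℝ) ^ 2 = α₀ * (314 * (F.L : ℝ) ^ 2) / 2 := by ring
          rw [h']; linarith
        rw [show (3 : ℕ) - 1 = 2 from rfl, inv_eq_one_div, lt_div_iff₀ hL2]
        exact h1)
      (fun c => by rw [hsum]; linarith [hμ c])

/-! ## §2 `dU_j⌊window ≪ descend_* dU_{j+1}` from a height -/

/-- ★★★ **WINDOW HAAR IS ABSOLUTELY CONTINUOUS W.R.T. THE LAW OF THE BLOCK AVERAGE, FROM A HEIGHT** (see the module docstring).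
[cite: Balaban1987RG1, (0.4) p.253 and (2.10) p.267; Balaban1985Averaging, (10)-(13) p.19] -/
theorem exists_height_window_absCont
    (F : T3Family) (γ b₀ p₀ : ℝ) (hγ : 0 < γ) (hγ1 : γ ≤ 1) (hb₀ : 0 < b₀) (hp₀ : 0 < p₀) :
    ∃ jA : ℕ, ∀ (j : ℕ), jA ≤ j →
      (fieldMeasure (F.P j) 0 ↥(Matrix.specialUnitaryGroup (Fin 2) ℂ)).restrict {V | PlaqSmall (θBal F.L γ b₀ p₀ j) V} ≪
        (fieldMeasure (F.P (j + 1)) 0 ↥(Matrix.specialUnitaryGroup (Fin 2) ℂ)).map (descend F ℰp j) := by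
  classical
  obtain ⟨j₁, h₁⟩ := exists_height_oneBondLaw F γ b₀ p₀ hγ hγ1 hb₀
  obtain ⟨j₂, h₂⟩ := spreadLift_height_all liftFloor_lt_twentyFour_div_twentyFive F hγ hγ1 hb₀ hp₀.le
  refine ⟨max j₁ j₂, fun j hj => ?_⟩
  obtain ⟨Ω, T, T', θ, jac, M, hΩm, hTm, hθm, hjm, hΩbl, hright, hlaw, hTo, hT'T, -, -, -, -, -, hToj, -, hsol, hjpos⟩ :=
    h₁ j (le_of_max_le_left hj)
  have hlift := h₂ j (le_of_max_le_right hj)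
  obtain ⟨s, -, hsm, hs, -⟩ := exists_continuous_section_descend F j
  -- names and standing facts
  set β : PBond (F.P j) 0 → PBond (F.P (j + 1)) 0 := fun c => centralBond (bondShift (sitesPerDir_descend F j 0) c) with hβ
  have hβi : Injective β := injective_private F j
  have hloc : IsLocal β (descend F ℰp j : GaugeField (F.P (j + 1)) 0 ↥(Matrix.specialUnitaryGroup (Fin 2) ℂ) → GaugeField (F.P j) 0 ↥(Matrix.specialUnitaryGroup (Fin 2) ℂ)) := isLocal_descend F j
  have hd : Measurable (descend F ℰp j : GaugeField (F.P (j + 1)) 0 ↥(Matrix.specialUnitaryGroup (Fin 2) ℂ) → GaugeField (F.P j) 0 ↥(Matrix.specialUnitaryGroup (Fin 2) ℂ)) := T3NestedUnitLaws.measurable_descend F ℰp measurableE_ℰp j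
  haveI : IsProbabilityMeasure (HaarData.haar : Measure ↥(Matrix.specialUnitaryGroup (Fin 2) ℂ)) := HaarData.isProb
  haveI : Nonempty ↥(Matrix.specialUnitaryGroup (Fin 2) ℂ) := ⟨1⟩
  haveI : (fieldMeasure (F.P (j + 1)) 0 ↥(Matrix.specialUnitaryGroup (Fin 2) ℂ)).IsOpenPosMeasure := B12ContinuousTransportInvariance.isOpenPosMeasure_fieldMeasure_SU 2 (F.P (j + 1)) 0
  set W : Set (GaugeField (F.P j) 0 ↥(Matrix.specialUnitaryGroup (Fin 2) ℂ)) := {V | PlaqSmall (θBal F.L γ b₀ p₀ j) V} with hW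
  have hWm : MeasurableSet W := by
    have e : W = ⋂ p : Plaq (F.P j) 0, {U | dist1 (GaugeField.plaqHol U p) < θBal F.L γ b₀ p₀ j} := by
      ext U; simp only [hW, PlaqSmall, Set.mem_setOf_eq, Set.mem_iInter]
    rw [e]; exact (isOpen_iInter_of_finite fun p => isOpen_lt (BalabanUVNodes.N07DirectMethod.continuous_dist1_plaqHol (N := 2) p) continuous_const).measurableSet
  -- the spliced chart and its Jacobian (lit T4TriangularFibredChart)
  set Good : Set (GaugeField (F.P j) 0 ↥(Matrix.specialUnitaryGroup (Fin 2) ℂ) × GaugeField (F.P (j + 1)) 0 ↥(Matrix.specialUnitaryGroup (Fin 2) ℂ)) := {p | ∀ c, p.1 c ∈ T c p.2} with hGood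
  have hGoodm : MeasurableSet Good := T4TriangularFibredChart.measurableSet_forall_mem_fst T hTm
  have hΦm := T4TriangularFibredChart.measurable_triChartSplice (β := β) T θ hβi hTm hθm hsm
  have hJm : Measurable fun p : GaugeField (F.P j) 0 ↥(Matrix.specialUnitaryGroup (Fin 2) ℂ) × GaugeField (F.P (j + 1)) 0 ↥(Matrix.specialUnitaryGroup (Fin 2) ℂ) => Good.indicator (fun p => ∏ c, jac c p.2 (p.1 c)) p :=
    T4TriangularFibredChart.measurable_triJacobian T jac hTm hjm
  have hmap := T4TriangularFibredChart.pi_restrict_preimage_inter_eq_map_prod_withDensity_splice (β := β) (A := descend F ℰp j) Ω T θ jac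
    (HaarData.haar : Measure ↥(Matrix.specialUnitaryGroup (Fin 2) ℂ)) (HaarData.haar : Measure ↥(Matrix.specialUnitaryGroup (Fin 2) ℂ)) hloc hβi hd hΩm hTm hθm hjm hΩbl hright hlaw s hWm
  have havgΦ := T4TriangularFibredChart.apply_triChartSplice_eq (β := β) (A := descend F ℰp j) T θ hloc hβi hright (σ := s) (U₀ := W) (fun V _ => hs V)
  -- positive FULL chart mass over every window datum
  have hmass : ∀ V ∈ W, 0 < ∫⁻ U, ((Good.indicator (fun p => ∏ c, jac c p.2 (p.1 c)) (V, U) : ℝ≥0) : ℝ≥0∞)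
      ∂(fieldMeasure (F.P (j + 1)) 0 ↥(Matrix.specialUnitaryGroup (Fin 2) ℂ)) := by
    intro V hV
    obtain ⟨U₁, hU₁V, hU₁s⟩ := hlift V hV
    have hG : IsOpen {U : GaugeField (F.P (j + 1)) 0 ↥(Matrix.specialUnitaryGroup (Fin 2) ℂ) | ∀ c, V c ∈ T c U} := by
      have e : {U : GaugeField (F.P (j + 1)) 0 ↥(Matrix.specialUnitaryGroup (Fin 2) ℂ) | ∀ c, V c ∈ T c U} =
          ⋂ c, (fun U : GaugeField (F.P (j + 1)) 0 ↥(Matrix.specialUnitaryGroup (Fin 2) ℂ) => (U, V c)) ⁻¹'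
            {p : GaugeField (F.P (j + 1)) 0 ↥(Matrix.specialUnitaryGroup (Fin 2) ℂ) × ↥(Matrix.specialUnitaryGroup (Fin 2) ℂ) | p.2 ∈ T c p.1} := by
        ext U; simp only [Set.mem_setOf_eq, Set.mem_iInter, Set.mem_preimage]
      rw [e]; exact isOpen_iInter_of_finite fun c => (hToj c).preimage (continuous_id.prodMk continuous_const)
    have hU₁G : U₁ ∈ {U : GaugeField (F.P (j + 1)) 0 ↥(Matrix.specialUnitaryGroup (Fin 2) ℂ) | ∀ c, V c ∈ T c U} := fun c => by
      have h := (hsol U₁ hU₁s c).1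
      rw [hU₁V] at h
      exact subset_closure.trans (hT'T c U₁) h
    have hpos : 0 < (fieldMeasure (F.P (j + 1)) 0 ↥(Matrix.specialUnitaryGroup (Fin 2) ℂ)) {U : GaugeField (F.P (j + 1)) 0 ↥(Matrix.specialUnitaryGroup (Fin 2) ℂ) | ∀ c, V c ∈ T c U} := hG.measure_pos _ ⟨U₁, hU₁G⟩
    have hJV : Measurable fun U : GaugeField (F.P (j + 1)) 0 ↥(Matrix.specialUnitaryGroup (Fin 2) ℂ) =>
        ((Good.indicator (fun p => ∏ c, jac c p.2 (p.1 c)) (V, U) : ℝ≥0) : ℝ≥0∞) :=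
      measurable_coe_nnreal_ennreal.fun_comp (hJm.fun_comp measurable_prodMk_left)
    rw [lintegral_pos_iff_support hJV]
    refine hpos.trans_le (measure_mono fun U hU => ?_)
    have hmem : (V, U) ∈ Good := hU
    rw [Function.mem_support, indicator_of_mem hmem, ne_eq, ENNReal.coe_eq_zero, Finset.prod_eq_zero_iff]
    rintro ⟨c, -, hc⟩
    exact hjpos c U (V c) (hU c) hc
  exact restrict_absolutelyContinuous_map_of_fibredChart (τ := fieldMeasure (F.P (j + 1)) 0 ↥(Matrix.specialUnitaryGroup (Fin 2) ℂ)) hWm hd hΦm hJm havgΦ hmap hmass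

end Summit.QuantumFields.YangMills.Theorems.FluctuationComparisonRegPrIntLOrganTangentWindowAbsContFromHeight

end
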